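import Summits.HodgeConjecture.HodgeConjecture.Cruxes.BlochSeedDiscOne.ShellLedger

/-!
# SheafDoorWindowBudget — the budget row of the letter sieve RE-PRICED PER SEMIREGULARITY WINDOW (answer (s2) to director-hodge R19.845 (2),
# seat `hsemireg-sheaf8-1` g9, 2026-08-31)

Token: `line stmt-HodgeConjecture-18881 Cruxes/BlochSeedDiscOne/Lines/birth.lean 814a6a70c14e831a stub_rung_pad4_seedAt`.

LETTER-MODEL BOOKKEEPING + ARITHMETIC ONLY; nothing here is proved toward HC ∕ HC_CM ∕ HC_AV ∕ № 4 ∕ 26512 ∕ 18881 ∕ 30548 ∕ H2.  Letters ≠ sheaves ≠ SEED.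

WHAT IS PRICED.  A sheaf-door certificate at window `I₀` (`4 ∈ I₀ ⊆ {0..8}`) asserts the JOINT injectivity of `(σ_q)_{q+1 ∈ I₀} : Ext²(𝓔,𝓔) →
⊕_q H^{q+2}(S⁴, Ω^q)`; the dimension count that is NECESSARY for it is `ext² ≤ B(I₀) := Σ_{q+1∈I₀} h^{q,q+2}(S⁴)`, `h^{p,q}(S⁴) = C(8,p)·C(8,q)` on the
abelian eightfold (`28, 448, 1960, 3136, 1960, 448, 28, 0` for `q = 0 … 7`).  The budget row OF RECORD `RuleDPlate.BudgetClause σ π D :=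
σ D + 28·(rank D − 4) + π ≤ 3136` is the case `I₀ = {4}` (σ₃ ALONE, target `h^{3,5} = 56² = 3136`), `π = 0`.  The crux of route № 3′ (`SheafSeedGaussSq`,
30548) takes the shifted-initial window `Icc 1 8`; a certificate at `{4}` re-windows to it for free (`RBDoorChainSheafCrux.sheafSeedCheckRankFree_rewindow`,
`IsISemiregular.mono`), a certificate that is only JOINTLY semiregular at `Icc 1 4` ∕ `Icc 1 8` is priced by `B = 5572` ∕ `8008 = C(16,6)`, i.e. by the
row of record with `π := 3136 − B(I₀) < 0`.  TRANSFER OF THE CLOSED SHELLS: shell 1 is budget-free (`ShellLedger.shell_one_closed`) and transfers to every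
window; at `π < 0` the arithmetic consequence of the row is only `copies + rank ≤ (B + 112)/28` (`203` ∕ `290`), so the ring-2 door `116 < copies + rank`
and the machine shells 3–4 (closed at `116`) do NOT transfer: the sieve of record sieves the σ₃-ALONE ansatz and nothing weaker.

Imports `ShellLedger` only (built).  No `sorry` ∕ axiom ∕ instance ∕ notation; `decide` only on closed numerals (`Nat.choose` sums over `range 8`).
-/

set_option linter.dupNamespace false
set_option autoImplicit false

namespace Summit.HodgeConjecture.HodgeConjecture.Cruxes.BlochSeedDiscOne.SheafDoorWindowBudget

open Summit.HodgeConjecture.HodgeConjecture.Cruxes.BlochSeedDiscOne.DepthBoundA4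
open Summit.HodgeConjecture.HodgeConjecture.Cruxes.BlochSeedDiscOne.RuleDPlate (BudgetClause)
open Summit.HodgeConjecture.HodgeConjecture.Cruxes.BlochSeedDiscOne.DeepLayerLaws (RingShellB RingRoomB)
open Summit.HodgeConjecture.HodgeConjecture.Cruxes.BlochSeedDiscOne.ShellLedger (shell_one_closed ringRoom_one_closed)

/-! ## §1 The model Hodge numbers of the abelian eightfold and the window budget -/

/-- `h^{p,q}(S⁴) = C(8,p)·C(8,q)` — the Hodge numbers of a complex abelian EIGHTFOLD (MODEL NUMBERS written down, not computed from any scheme of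
the tree; `h^{3,5} = 56² = 3136` is the budget of record). [cite: MumfordAV1970, §1 (cohomology of complex tori)] -/
def hodgeE8 (p q : ℕ) : ℕ := Nat.choose 8 p * Nat.choose 8 q

/-- **`B(I₀)`** — the target dimension of the joint semiregularity map at window `I₀`: `Σ_{q < 8, q+1 ∈ I₀} h^{q,q+2}(S⁴)`.
[cite: BuchweitzFlenner2003, §5 (I-semiregular)] -/
def windowBudget (I₀ : Finset ℕ) : ℕ := ∑ q ∈ (Finset.range 8).filter (fun q => q + 1 ∈ I₀), hodgeE8 q (q + 2)

theorem hodgeE8_diag_two : (List.range 8).map (fun q => hodgeE8 q (q + 2)) = [28, 448, 1960, 3136, 1960, 448, 28, 0] := by decide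

/-- the window of record `{4}` (σ₃ alone): `B = h^{3,5} = 3136`. -/
theorem windowBudget_four : windowBudget {4} = 3136 := by decide

/-- `Icc 1 4` (σ₀ … σ₃ jointly): `B = 28 + 448 + 1960 + 3136 = 5572`. -/
theorem windowBudget_icc_one_four : windowBudget (Finset.Icc 1 4) = 5572 := by decide

/-- `Icc 1 8` (all of σ₀ … σ₇ jointly; route № 3′'s window): `B = 8008`. -/
theorem windowBudget_icc_one_eight : windowBudget (Finset.Icc 1 8) = 8008 := by decide

/-- `Icc 0 8` gives the same `8008` (`0 ∈ I₀` tests nothing). -/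
theorem windowBudget_icc_zero_eight : windowBudget (Finset.Icc 0 8) = 8008 := by decide

/-- `8008 = C(16,6)` (Vandermonde). -/
theorem windowBudget_icc_one_eight_eq_choose : windowBudget (Finset.Icc 1 8) = Nat.choose 16 6 := by decide

/-- the stable-range window `{4..8}`: `B = 3136 + 1960 + 448 + 28 + 0 = 5572` as well (by the symmetry `h^{q,q+2} = h^{6−q,8−q}`). -/
theorem windowBudget_icc_four_eight : windowBudget (Finset.Icc 4 8) = 5572 := by decide

/-- `B` is monotone in the window. -/
theorem windowBudget_mono {I J : Finset ℕ} (h : I ⊆ J) : windowBudget I ≤ windowBudget J := by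
  unfold windowBudget
  apply Finset.sum_le_sum_of_subset_of_nonneg
  · intro q hq
    simp only [Finset.mem_filter] at hq ⊢
    exact ⟨hq.1, h hq.2⟩
  · intro _ _ _
    exact Nat.zero_le _

/-- every window containing `4` has `B ≥ 3136`: the row of record is the STRONGEST sieve among the windows. -/
theorem windowBudget_ge_of_four_mem {I₀ : Finset ℕ} (h4 : 4 ∈ I₀) : 3136 ≤ windowBudget I₀ := by
  rw [← windowBudget_four]
  exact windowBudget_mono (Finset.singleton_subset_iff.mpr h4)

/-! ## §2 The budget row at window `I₀` = the row of record with `π := 3136 − B(I₀)` -/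

/-- **the budget row at window `I₀`**: `σ D + 28·(rank − 4) ≤ B(I₀)`. -/
def BudgetClauseW (σ : Design → ℤ) (I₀ : Finset ℕ) (D : Design) : Prop := σ D + 28 * (D.rank - 4) ≤ (windowBudget I₀ : ℤ)

/-- it IS the row of record with the (negative) rider `π = 3136 − B(I₀)`. -/
theorem budgetClauseW_iff (σ : Design → ℤ) (I₀ : Finset ℕ) (D : Design) :
    BudgetClauseW σ I₀ D ↔ BudgetClause σ (3136 - (windowBudget I₀ : ℤ)) D := by
  unfold BudgetClauseW BudgetClause
  omega

/-- at the window of record it is the row of record verbatim (`π = 0`). -/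
theorem budgetClauseW_four_iff (σ : Design → ℤ) (D : Design) : BudgetClauseW σ {4} D ↔ BudgetClause σ 0 D := by
  rw [budgetClauseW_iff, windowBudget_four]
  norm_num

/-- the riders for the two joint windows: `π = −2436` (`Icc 1 4`) and `π = −4872` (`Icc 1 8`). -/
theorem riders : (3136 : ℤ) - (windowBudget (Finset.Icc 1 4) : ℤ) = -2436 ∧ (3136 : ℤ) - (windowBudget (Finset.Icc 1 8) : ℤ) = -4872 := by
  rw [windowBudget_icc_one_four, windowBudget_icc_one_eight]
  norm_num

/-- a larger window is a WEAKER row (monotonicity). -/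
theorem budgetClauseW_mono {σ : Design → ℤ} {I J : Finset ℕ} (h : I ⊆ J) {D : Design} (hb : BudgetClauseW σ I D) :
    BudgetClauseW σ J D := by
  unfold BudgetClauseW at hb ⊢
  have := windowBudget_mono h
  omega

/-- **what the row at window `I₀` buys arithmetically** under `σ ≥ 28·copies` (e.g. `σ_H`, `SigmaH.diag_le_sigmaH`): `28·(copies + rank) ≤ B(I₀) + 112`,
i.e. `copies + rank ≤ 116 ∕ 203 ∕ 290` at `{4}` ∕ `Icc 1 4` ∕ `Icc 1 8` (cf. `ShellLedger.copies_add_rank_le_116_of_budget`). -/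
theorem copies_add_rank_le_of_budgetW (σ : Design → ℤ) (I₀ : Finset ℕ) {D : Design} (hσ : 28 * (D.copies : ℤ) ≤ σ D)
    (hb : BudgetClauseW σ I₀ D) : 28 * ((D.copies : ℤ) + D.rank) ≤ (windowBudget I₀ : ℤ) + 112 := by
  unfold BudgetClauseW at hb
  omega

theorem copies_add_rank_le_203 (σ : Design → ℤ) {D : Design} (hσ : 28 * (D.copies : ℤ) ≤ σ D)
    (hb : BudgetClauseW σ (Finset.Icc 1 4) D) : (D.copies : ℤ) + D.rank ≤ 203 := by
  have h := copies_add_rank_le_of_budgetW σ _ hσ hb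
  rw [windowBudget_icc_one_four] at h
  omega

theorem copies_add_rank_le_290 (σ : Design → ℤ) {D : Design} (hσ : 28 * (D.copies : ℤ) ≤ σ D)
    (hb : BudgetClauseW σ (Finset.Icc 1 8) D) : (D.copies : ℤ) + D.rank ≤ 290 := by
  have h := copies_add_rank_le_of_budgetW σ _ hσ hb
  rw [windowBudget_icc_one_eight] at h
  omega

/-! ## §3 Transfer of the closed shells: shell 1 at every window; nothing else is claimed -/

/-- SHELL 1 is budget-free, so it is closed at EVERY window (`ShellLedger.shell_one_closed`). -/
theorem shell_one_closed_window (h : ℤ) (σ : Design → ℤ) (I₀ : Finset ℕ) : RingShellB h (BudgetClauseW σ I₀) 1 :=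
  shell_one_closed h _

theorem ringRoom_one_closed_window (h : ℤ) (σ : Design → ℤ) (I₀ : Finset ℕ) : RingRoomB h (BudgetClauseW σ I₀) 1 :=
  ringRoom_one_closed h _

/-- a closed shell ∕ room at the window of record IS a closed shell ∕ room for `BudgetClauseW σ {4}` (same predicate up to `↔`). -/
theorem ringRoomB_four_of_record {h : ℤ} {σ : Design → ℤ} {c : ℤ} (H : RingRoomB h (BudgetClause σ 0) c) :
    RingRoomB h (BudgetClauseW σ {4}) c :=
  fun D hA hd h1 hr hu hp hμ hb hR => H D hA hd h1 hr hu hp hμ ((budgetClauseW_four_iff σ D).mp hb) hR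

/-- and a room closed at a LARGER window is closed at every smaller one (weaker row ⇒ fewer designs to exclude is the wrong way round: a design passing the
smaller window's row passes the larger one's, so closure at `J` gives closure at `I ⊆ J`). -/
theorem ringRoomB_window_anti {h : ℤ} {σ : Design → ℤ} {c : ℤ} {I J : Finset ℕ} (hIJ : I ⊆ J) (H : RingRoomB h (BudgetClauseW σ J) c) :
    RingRoomB h (BudgetClauseW σ I) c :=
  fun D hA hd h1 hr hu hp hμ hb hR => H D hA hd h1 hr hu hp hμ (budgetClauseW_mono hIJ hb) hR

/-- AUDIT: arithmetic and bookkeeping; nothing decided about any crux. -/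
theorem audit_nothing_decided : True := trivial

end Summit.HodgeConjecture.HodgeConjecture.Cruxes.BlochSeedDiscOne.SheafDoorWindowBudget
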